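import Literature.NumberTheory.Sieve.MaynardTaoProofs
import Literature.NumberTheory.Sieve.MaynardTaoLargeKProofs
import Literature.NumberTheory.Sieve.PolymathMkEpsCauchySchwarz
import HarnessLib

/-!
# Polymath 8b Lemma 6.1 for the plain functional `M_k` with GENERAL weights, and the
# Collatz–Wielandt (sub-eigenfunction) upper bound `M_k ≤ sup (ℒG)/G`

Topic `Literature/NumberTheory/Sieve`; companion of `MaynardTaoProofs.lean` (which proves Lemma 6.1 only
with the hard-wired weights of Corollary 6.4, `maynardFunctional_le_holds`) and of
`PolymathMkEpsCauchySchwarz.lean` (`polymathFunctional_le_of_weights`, the same device for the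
`ε`-enlarged functional `polymathFunctional`).  Source: D. H. J. Polymath, *Variants of the Selberg sieve,
and bounded intervals containing many primes*, Res. Math. Sci. 1:12 (2014) = arXiv:1407.4897v4, §6,
Lemma 6.1 (p. 24) and the proof of Corollary 6.2 (p. 24), with the operator `ℒ` of §7.1 (p. 30).

* `MaynardCW.ofReal_maynardJ_le` — **Lemma 6.1, one coordinate, general weight**: if `w ≥ 0` is measurable,
  positive where `F ≠ 0, t_m > 0`, and every fibre of `R_k` over an outer point `s` has budget
  `∫_{(0, 1-∑s]} du / w(s with s_m := u) ≤ 1`, then `J_k^{(m)}(F) ≤ ∫ w F²` (in `ℝ≥0∞`, no integrability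
  of `w F²` needed).  Printed form: `w = 1/G_m`, budget `∫₀^∞ G_m dt_m ≤ 1`.
* `maynardFunctional_le_of_weights` — **Lemma 6.1 (plain functional, general weights)**: with such weights
  `w_0, …, w_n` and the pointwise bound `∑_m 1[t_m > 0] w_m(t) ≤ M` on `R_k`,
  `(∑_m J_k^{(m)}(F))/I_k(F) ≤ M` for every admissible `F`; `maynardFunctional_le_of_weights'` is the
  variant with the simpler pointwise hypothesis `∑_m w_m ≤ M`, `w_m ≥ 0` on `R_k`.
* `maynardFunctional_le_of_subsolution` — **Collatz–Wielandt form** (the substitution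
  `G_i := G/(∫ G dt_i)` of the proof of Corollary 6.2): if `G` is measurable, bounded and positive on `R_k`
  and `(ℒG)(t) = ∑_m ∫₀^{1-∑_{j≠m} t_j} G(t with t_m := u) du ≤ Λ·G(t)` on `R_k`, then
  `maynardFunctional k F ≤ Λ` for every admissible `F` — the `F`-independent checker statement behind any
  upper-bound certificate for `M_k` built from a positive test function (Corollary 6.4 is the case
  `G`-free weights `w_m = (log k/(k-1))(1 - ∑t + k t_m)`).

No new named facts; all statements are theorems. The fibre Cauchy–Schwarz step is the tree's
`MkEps.ofReal_sq_setIntegral_Ioi_le`; the coordinate is split off with the volume-preserving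
`MeasurableEquiv.piFinSuccAbove` and the fibres are reassembled by Tonelli exactly as in
`MaynardTao.maynardJ_le`.

## References
* [Polymath8b2014] D. H. J. Polymath, *Variants of the Selberg sieve, and bounded intervals containing
  many primes*, Res. Math. Sci. 1 (2014), Art. 12 = arXiv:1407.4897v4: Lemma 6.1 and its proof, Corollary
  6.2 and its proof (p. 24); the operator `ℒ` (§7.1, p. 30).
* K. Broughan, *Bounded Gaps Between Primes* (Cambridge Univ. Press, 2021), Lemma 7.8 and Corollary 7.9
  (= Polymath's Lemma 6.1 / Corollary 6.2 with proofs), §7.6.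
-/

noncomputable section

open MeasureTheory Set Filter Finset
open scoped ENNReal BigOperators

namespace Literature.NumberTheory.Sieve

namespace MaynardCW

variable {n : ℕ}

/-! ### Lemma 6.1 for one coordinate, general weight -/

/-- If `F` is supported on `R_{n+1}` then on a fibre over an outer point `s` the section
`u ↦ F(insertNth m u s)` vanishes unless `0 ≤ u`, `∀ j, 0 ≤ s j` and `u + ∑ s ≤ 1`. [folklore] -/
private theorem section_eq_zero_of_not_mem (m : Fin (n + 1)) {F : (Fin (n + 1) → ℝ) → ℝ}
    (hF : Function.support F ⊆ maynardSimplex (n + 1)) {u : ℝ} {s : Fin n → ℝ}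
    (h : ¬ ((0 ≤ u ∧ ∀ j, 0 ≤ s j) ∧ u + ∑ j, s j ≤ 1)) : F (Fin.insertNth m u s) = 0 := by
  by_contra hne
  exact h ((MaynardLargeK.insertNth_mem_maynardSimplex_iff m u s).1 (hF (Function.mem_support.2 hne)))

/-- **Polymath 8b Lemma 6.1, one coordinate, general weight** (in `ℝ≥0∞`).  Let `F` be admissible on
`R_{n+1}`, `w` a measurable weight with `w(t) > 0` whenever `F t ≠ 0` and `t_m > 0`, and suppose every
fibre over an outer point `s ≥ 0`, `∑ s ≤ 1`, has budget `∫_{(0,1-∑s]} du / w(s with s_m := u) ≤ 1`.  Then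
`J_{n+1}^{(m)}(F) ≤ ∫ w F²`.  (Printed: `G_m = 1/w`, `∫₀^∞ G_m dt_m ≤ 1` gives
`J_m(F) ≤ ∫_{R_k} F²/G_m`.) [cite: Polymath8b2014, Lemma 6.1 (proof)] -/
theorem ofReal_maynardJ_le (m : Fin (n + 1)) {F : (Fin (n + 1) → ℝ) → ℝ}
    (hF : IsMaynardAdmissible (n + 1) F) (w : (Fin (n + 1) → ℝ) → ℝ) (hw : Measurable w)
    (hpos : ∀ t, F t ≠ 0 → 0 < t m → 0 < w t)
    (hbudget : ∀ s : Fin n → ℝ, (∀ j, 0 ≤ s j) → ∑ j, s j ≤ 1 →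
      ∫⁻ u in Ioc (0:ℝ) (1 - ∑ j, s j), ENNReal.ofReal (w (Fin.insertNth m u s))⁻¹ ≤ 1) :
    ENNReal.ofReal (maynardJ (n + 1) m F) ≤ ∫⁻ t, ENNReal.ofReal (w t * F t ^ 2) := by
  have hFm : Measurable F := hF.measurable
  -- the integrand `G = ofReal (w F²)`
  obtain ⟨G, hG⟩ : ∃ G : (Fin (n + 1) → ℝ) → ℝ≥0∞,
      G = fun t => ENNReal.ofReal (w t * F t ^ 2) := ⟨_, rfl⟩
  have hGm : Measurable G := by rw [hG]; exact (hw.mul (hFm.pow_const 2)).ennreal_ofReal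
  -- splitting off the `m`-th coordinate: `e.symm (x, s) = Fin.insertNth m x s`
  set e := MeasurableEquiv.piFinSuccAbove (fun _ : Fin (n + 1) => ℝ) m with he_def
  have he : MeasurePreserving e.symm volume volume :=
    (volume_preserving_piFinSuccAbove (fun _ : Fin (n + 1) => ℝ) m).symm
  have he_apply : ∀ p : ℝ × (Fin n → ℝ), e.symm p = Fin.insertNth m p.1 p.2 := fun p => by
    rw [he_def, MeasurableEquiv.piFinSuccAbove_symm_apply]; rfl
  -- the fibre integrals `Λ s = ∫ G (insertNth m u s) du`
  obtain ⟨Λ, hΛ⟩ : ∃ Λ : (Fin n → ℝ) → ℝ≥0∞, Λ = fun s => ∫⁻ u, G (e.symm (u, s)) := ⟨_, rfl⟩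
  have hΛm : Measurable Λ := by
    rw [hΛ]; exact (hGm.comp e.symm.measurable).lintegral_prod_left'
  -- fibrewise Cauchy–Schwarz with the general weight
  have hfib : ∀ s : Fin n → ℝ,
      ENNReal.ofReal ((∫ u in (0:ℝ)..1, F (Fin.insertNth m u s)) ^ 2) ≤ Λ s := by
    intro s
    have hgm : Measurable fun u : ℝ => F (Fin.insertNth m u s) :=
      hFm.comp (continuous_id.finInsertNth m continuous_const).measurable
    have hwm : Measurable fun u : ℝ => w (Fin.insertNth m u s) :=
      hw.comp (continuous_id.finInsertNth m continuous_const).measurable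
    by_cases hs : (∀ j, 0 ≤ s j) ∧ ∑ j, s j ≤ 1
    · -- the fibre meets `R_k`: `∫₀¹ = ∫_{u>0}` and the weighted Cauchy–Schwarz applies
      have hIoc : ∫ u in (0:ℝ)..1, F (Fin.insertNth m u s) = ∫ u in Ioi (0:ℝ), F (Fin.insertNth m u s) := by
        rw [intervalIntegral.integral_of_le zero_le_one]
        refine (setIntegral_eq_of_subset_of_forall_sdiff_eq_zero measurableSet_Ioi
          Ioc_subset_Ioi_self fun u hu => ?_).symm
        refine section_eq_zero_of_not_mem m hF.support_subset fun h => hu.2 ⟨hu.1, ?_⟩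
        have h0 : 0 ≤ ∑ j, s j := Finset.sum_nonneg fun j _ => hs.1 j
        linarith [h.2]
      have hcs := MkEps.ofReal_sq_setIntegral_Ioi_le (L := 1 - ∑ j, s j) hgm hwm (fun u hu hne => by
        have hmem : Fin.insertNth m u s ∈ maynardSimplex (n + 1) :=
          hF.support_subset (Function.mem_support.2 hne)
        have h' := (MaynardLargeK.insertNth_mem_maynardSimplex_iff m u s).1 hmem
        refine ⟨by linarith [h'.2], hpos _ hne ?_⟩
        simpa using hu)
      rw [hIoc]
      refine hcs.trans ?_
      calc (∫⁻ u in Ioc (0:ℝ) (1 - ∑ j, s j), ENNReal.ofReal (w (Fin.insertNth m u s))⁻¹) *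
            ∫⁻ u in Ioi (0:ℝ), ENNReal.ofReal (w (Fin.insertNth m u s) * F (Fin.insertNth m u s) ^ 2)
          ≤ 1 * ∫⁻ u, ENNReal.ofReal (w (Fin.insertNth m u s) * F (Fin.insertNth m u s) ^ 2) :=
            mul_le_mul' (hbudget s hs.1 hs.2) (lintegral_mono' Measure.restrict_le_self le_rfl)
        _ = Λ s := by
            rw [one_mul, hΛ]
            refine lintegral_congr fun u => ?_
            rw [he_apply, hG]
    · -- the fibre misses `R_k`: the section vanishes identically
      have hzero : ∀ u, F (Fin.insertNth m u s) = 0 := fun u =>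
        section_eq_zero_of_not_mem m hF.support_subset fun h => hs ⟨h.1.2, by linarith [h.2, h.1.1]⟩
      simp [hzero]
  -- `cube ⊆ T := {t | t m ∈ [0,1]}` and `e.symm ⁻¹' T = [0,1] × univ`
  have hsub : maynardCube (n + 1) ⊆ {t | t m ∈ Icc (0:ℝ) 1} := fun t ht => ht m (Set.mem_univ _)
  have hpre : e.symm ⁻¹' {t : Fin (n + 1) → ℝ | t m ∈ Icc (0:ℝ) 1} =
      Icc (0:ℝ) 1 ×ˢ (univ : Set (Fin n → ℝ)) := by
    ext ⟨x, s⟩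
    simp [he_apply]
  -- Tonelli
  have hswap : ∫⁻ s, Λ s = ∫⁻ t, G t := by
    rw [← he.lintegral_comp_emb e.symm.measurableEmbedding G, Measure.volume_eq_prod, hΛ]
    exact (lintegral_prod_symm (G ∘ e.symm) (hGm.comp e.symm.measurable).aemeasurable).symm
  have hind : (maynardSimplex (n + 1)).indicator F = F := Set.indicator_eq_self.2 hF.support_subset
  calc ENNReal.ofReal (maynardJ (n + 1) m F)
      ≤ ‖maynardJ (n + 1) m F‖ₑ := Real.ofReal_le_enorm _
    _ ≤ ∫⁻ t in maynardCube (n + 1),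
          ‖(∫ u in (0:ℝ)..1, F (Function.update t m u)) ^ 2‖ₑ := by
        rw [maynardJ, hind]; exact enorm_integral_le_lintegral_enorm _
    _ = ∫⁻ t in maynardCube (n + 1),
          ENNReal.ofReal ((∫ u in (0:ℝ)..1, F (Function.update t m u)) ^ 2) :=
        lintegral_congr fun t => Real.enorm_eq_ofReal (sq_nonneg _)
    _ ≤ ∫⁻ t in {t | t m ∈ Icc (0:ℝ) 1},
          ENNReal.ofReal ((∫ u in (0:ℝ)..1, F (Function.update t m u)) ^ 2) :=
        lintegral_mono_set hsub
    _ = ∫⁻ p in e.symm ⁻¹' {t : Fin (n + 1) → ℝ | t m ∈ Icc (0:ℝ) 1},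
          ENNReal.ofReal ((∫ u in (0:ℝ)..1, F (Function.update (e.symm p) m u)) ^ 2) :=
        (he.setLIntegral_comp_preimage_emb e.symm.measurableEmbedding _ _).symm
    _ = ∫⁻ p in Icc (0:ℝ) 1 ×ˢ (univ : Set (Fin n → ℝ)),
          ENNReal.ofReal ((∫ u in (0:ℝ)..1, F (Fin.insertNth m u p.2)) ^ 2) := by
        rw [hpre]
        simp_rw [he_apply, Fin.update_insertNth]
    _ ≤ ∫⁻ p in Icc (0:ℝ) 1 ×ˢ (univ : Set (Fin n → ℝ)), Λ p.2 := lintegral_mono fun p => hfib p.2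
    _ = ∫⁻ s, Λ s := by
        rw [Measure.volume_eq_prod, ← Measure.prod_restrict, Measure.restrict_univ]
        refine (lintegral_prod_symm (fun p : ℝ × (Fin n → ℝ) => Λ p.2) ?_).trans ?_
        · exact (hΛm.comp measurable_snd).aemeasurable
        · simp [lintegral_const, Real.volume_Icc]
    _ = ∫⁻ t, G t := hswap
    _ = ∫⁻ t, ENNReal.ofReal (w t * F t ^ 2) := by rw [hG]

end MaynardCW

open MaynardCW in
/-- **Polymath 8b Lemma 6.1 for the plain functional, general weights.**  Let `F` be admissible on
`R_{n+1}` and `w_0, …, w_n` measurable weights such that, for each `m`, `w_m(t) > 0` whenever `F t ≠ 0`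
and `t_m > 0`, and every fibre of `R_{n+1}` over an outer point `s ≥ 0`, `∑ s ≤ 1`, has budget
`∫_{(0,1-∑s]} du / w_m(s with s_m := u) ≤ 1`.  If POINTWISE on `R_{n+1}` `∑_m 1[t_m > 0]·w_m(t) ≤ M`, then
`(∑_m J^{(m)}(F))/I(F) ≤ M`.  (Printed: `w_m = 1/G_m`, `∫₀^∞ G_m dt_m ≤ 1`, `M_k ≤ ess sup ∑ 1/G_m`.)
[cite: Polymath8b2014, Lemma 6.1] -/
theorem maynardFunctional_le_of_weights {n : ℕ} {M : ℝ} (hM : 0 ≤ M) {F : (Fin (n + 1) → ℝ) → ℝ}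
    (hF : IsMaynardAdmissible (n + 1) F) (w : Fin (n + 1) → (Fin (n + 1) → ℝ) → ℝ)
    (hw : ∀ m, Measurable (w m))
    (hpos : ∀ m t, F t ≠ 0 → 0 < t m → 0 < w m t)
    (hbudget : ∀ m (s : Fin n → ℝ), (∀ j, 0 ≤ s j) → ∑ j, s j ≤ 1 →
      ∫⁻ u in Ioc (0:ℝ) (1 - ∑ j, s j), ENNReal.ofReal (w m (Fin.insertNth m u s))⁻¹ ≤ 1)
    (hpt : ∀ t ∈ maynardSimplex (n + 1), ∑ m, (if 0 < t m then w m t else 0) ≤ M) :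
    maynardFunctional (n + 1) F ≤ M := by
  have hFm : Measurable F := hF.measurable
  unfold maynardFunctional
  rw [div_le_iff₀ hF.maynardI_pos]
  -- `J_m ≤ ∫ 1[t_m > 0] w_m F²` in `ℝ≥0∞`, with the truncated weight `w'_m = 1[t_m>0] w_m`
  set w' : Fin (n + 1) → (Fin (n + 1) → ℝ) → ℝ := fun m t => if 0 < t m then w m t else 0 with hw'
  have hw'm : ∀ m, Measurable (w' m) := fun m =>
    Measurable.ite (measurableSet_lt measurable_const (measurable_pi_apply m)) (hw m) measurable_const
  have hJ : ∀ m, ENNReal.ofReal (maynardJ (n + 1) m F) ≤ ∫⁻ t, ENNReal.ofReal (w' m t * F t ^ 2) := by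
    intro m
    refine ofReal_maynardJ_le m hF (w' m) (hw'm m) (fun t ht htm => ?_) (fun s hs0 hs1 => ?_)
    · simp only [hw', if_pos htm]; exact hpos m t ht htm
    · refine le_trans (le_of_eq (setLIntegral_congr_fun measurableSet_Ioc fun u hu => ?_))
        (hbudget m s hs0 hs1)
      simp only [hw', Fin.insertNth_apply_same, if_pos hu.1]
  -- pointwise bound of the summed integrand
  have hnn : ∀ m t, 0 ≤ w' m t * F t ^ 2 := by
    intro m t
    by_cases hFt : F t = 0
    · simp [hFt]
    by_cases htm : 0 < t m
    · simp only [hw', if_pos htm]; exact mul_nonneg (hpos m t hFt htm).le (sq_nonneg _)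
    · simp [hw', if_neg htm]
  have hpt' : ∀ t, ∑ m, ENNReal.ofReal (w' m t * F t ^ 2) ≤ ENNReal.ofReal (M * F t ^ 2) := by
    intro t
    by_cases hFt : F t = 0
    · simp [hFt]
    have ht : t ∈ maynardSimplex (n + 1) := hF.support_subset (Function.mem_support.2 hFt)
    rw [← ENNReal.ofReal_sum_of_nonneg (fun m _ => hnn m t), ← Finset.sum_mul]
    exact ENNReal.ofReal_le_ofReal (mul_le_mul_of_nonneg_right (hpt t ht) (sq_nonneg _))
  have hmeas : ∀ m, Measurable fun t => ENNReal.ofReal (w' m t * F t ^ 2) :=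
    fun m => ((hw'm m).mul (hFm.pow_const 2)).ennreal_ofReal
  have hint : Integrable fun t => M * F t ^ 2 := (MaynardTao.integrable_sq hF).const_mul M
  have hI : maynardI (n + 1) F = ∫ t, F t ^ 2 := by
    refine setIntegral_eq_integral_of_forall_compl_eq_zero fun t ht => ?_
    have : F t = 0 := Function.notMem_support.1 fun h => ht (hF.support_subset h)
    simp [this]
  have hmain : ENNReal.ofReal (∑ m, maynardJ (n + 1) m F) ≤ ENNReal.ofReal (M * maynardI (n + 1) F) := by
    calc ENNReal.ofReal (∑ m, maynardJ (n + 1) m F)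
        = ∑ m, ENNReal.ofReal (maynardJ (n + 1) m F) :=
          ENNReal.ofReal_sum_of_nonneg fun m _ => integral_nonneg fun _ => sq_nonneg _
      _ ≤ ∑ m, ∫⁻ t, ENNReal.ofReal (w' m t * F t ^ 2) := Finset.sum_le_sum fun m _ => hJ m
      _ = ∫⁻ t, ∑ m, ENNReal.ofReal (w' m t * F t ^ 2) := (lintegral_finsetSum' _ fun m _ =>
          (hmeas m).aemeasurable).symm
      _ ≤ ∫⁻ t, ENNReal.ofReal (M * F t ^ 2) := lintegral_mono hpt'
      _ = ENNReal.ofReal (∫ t, M * F t ^ 2) :=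
          (ofReal_integral_eq_lintegral_ofReal hint (ae_of_all _ fun t => by positivity)).symm
      _ = ENNReal.ofReal (M * maynardI (n + 1) F) := by rw [integral_const_mul, hI]
  exact (ENNReal.ofReal_le_ofReal_iff (mul_nonneg hM (integral_nonneg fun _ => sq_nonneg _))).1 hmain

/-- **Lemma 6.1, plain functional, with the simpler pointwise hypothesis** `w_m ≥ 0` and `∑_m w_m ≤ M` on
`R_{n+1}` (the printed `ess sup ∑ᵢ 1/Gᵢ ≤ M` for everywhere-defined positive weights).
[cite: Polymath8b2014, Lemma 6.1] -/
theorem maynardFunctional_le_of_weights' {n : ℕ} {M : ℝ} (hM : 0 ≤ M) {F : (Fin (n + 1) → ℝ) → ℝ}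
    (hF : IsMaynardAdmissible (n + 1) F) (w : Fin (n + 1) → (Fin (n + 1) → ℝ) → ℝ)
    (hw : ∀ m, Measurable (w m))
    (hpos : ∀ m t, F t ≠ 0 → 0 < t m → 0 < w m t)
    (hnonneg : ∀ m, ∀ t ∈ maynardSimplex (n + 1), 0 ≤ w m t)
    (hbudget : ∀ m (s : Fin n → ℝ), (∀ j, 0 ≤ s j) → ∑ j, s j ≤ 1 →
      ∫⁻ u in Ioc (0:ℝ) (1 - ∑ j, s j), ENNReal.ofReal (w m (Fin.insertNth m u s))⁻¹ ≤ 1)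
    (hpt : ∀ t ∈ maynardSimplex (n + 1), ∑ m, w m t ≤ M) :
    maynardFunctional (n + 1) F ≤ M :=
  maynardFunctional_le_of_weights hM hF w hw hpos hbudget fun t ht =>
    (Finset.sum_le_sum fun m _ => by
      by_cases h : 0 < t m
      · rw [if_pos h]
      · rw [if_neg h]; exact hnonneg m t ht).trans (hpt t ht)


/-! ### The operator `ℒ` of Polymath 8b §7.1 and the Collatz–Wielandt upper bound -/

namespace MaynardCW

variable {n : ℕ}

/-- The `m`-th fibre integral `(P_m G)(t) = ∫₀^{1 - ∑_{j ≠ m} t_j} G(t_1,…,t_{m-1},u,t_{m+1},…,t_k) du` of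
Polymath 8b's operator `ℒ = ∑_m P_m` (§7.1, p. 30: "`ℒf(t_1,…,t_k) := ∑_{i=1}^k ∫_0^{1-t_1-…-t_{i-1}-t_{i+1}-…-t_k}
f(t_1,…,t_{i-1},t'_i,t_{i+1},…,t_k) dt'_i`"), as a set integral over `(0, 1 - ∑_{j≠m} t_j]`.
[cite: Polymath8b2014, §7.1 (definition of the operator L, p. 30)] -/
def fibreIntegral (m : Fin (n + 1)) (G : (Fin (n + 1) → ℝ) → ℝ) (t : Fin (n + 1) → ℝ) : ℝ :=
  ∫ u in Ioc (0:ℝ) (1 - ∑ j ∈ univ.erase m, t j), G (Function.update t m u)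

/-- Polymath 8b's operator `(ℒG)(t) = ∑_{m} ∫₀^{1 - ∑_{j≠m} t_j} G(t with t_m := u) du` on functions on
`R_{n+1}` (§7.1, p. 30; "a self-adjoint and positive semi-definite operator on `L²(R_k)`" whose top of
spectrum is `M_k`). [cite: Polymath8b2014, §7.1 (definition of the operator L, p. 30)] -/
def maynardOperator (G : (Fin (n + 1) → ℝ) → ℝ) (t : Fin (n + 1) → ℝ) : ℝ :=
  ∑ m, fibreIntegral m G t

/-- Unfolding `maynardOperator`: `ℒ = ∑_m P_m`. [cite: Polymath8b2014, §7.1 (definition of the operator L, p. 30)] -/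
theorem maynardOperator_def (G : (Fin (n + 1) → ℝ) → ℝ) (t : Fin (n + 1) → ℝ) :
    maynardOperator G t = ∑ m, fibreIntegral m G t := rfl

/-- The fibre integral as an interval integral `∫ u in 0..(1 - ∑_{j≠m} t_j)` when the upper limit is
nonnegative (e.g. for `t ∈ R_{n+1}`): the printed `∫_0^{1-t_1-…-t_{i-1}-t_{i+1}-…-t_k} … dt'_i`. [cite: Polymath8b2014, §7.1 (definition of the operator L, p. 30)] -/
theorem fibreIntegral_eq_intervalIntegral (m : Fin (n + 1)) (G : (Fin (n + 1) → ℝ) → ℝ)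
    {t : Fin (n + 1) → ℝ} (ht : 0 ≤ 1 - ∑ j ∈ univ.erase m, t j) :
    fibreIntegral m G t = ∫ u in (0:ℝ)..(1 - ∑ j ∈ univ.erase m, t j), G (Function.update t m u) := by
  rw [fibreIntegral, intervalIntegral.integral_of_le ht]

/-- The upper limit of the `m`-th fibre integral of `ℒ`: `1 - ∑_{j≠m} t_j = 1 - ∑ t + t_m` (so `≥ t_m ≥ 0` on `R_{n+1}`; Cor. 6.4's weight `1 - t_1 - ⋯ - t_k + k t_i` is built from it). [cite: Polymath8b2014, §7.1 (definition of the operator L, p. 30)] -/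
theorem sub_sum_erase_eq (m : Fin (n + 1)) (t : Fin (n + 1) → ℝ) :
    1 - ∑ j ∈ univ.erase m, t j = 1 - ∑ j, t j + t m := by
  rw [← Finset.add_sum_erase _ _ (Finset.mem_univ m)]; ring

/-- On a fibre over the outer point `s`: `1 - ∑_{j≠m} (insertNth m u s)_j = 1 - ∑ s`, i.e. the length of the `t_m`-fibre of `R_k` does not depend on `t_m` (proof of Lemma 6.1: "for all `t_1,…,t_{i-1},t_{i+1},…,t_k ≥ 0`"). [cite: Polymath8b2014, Lemma 6.1 (proof)] -/
theorem sub_sum_erase_insertNth (m : Fin (n + 1)) (u : ℝ) (s : Fin n → ℝ) :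
    1 - ∑ j ∈ univ.erase m, Fin.insertNth (α := fun _ => ℝ) m u s j = 1 - ∑ j, s j := by
  rw [sub_sum_erase_eq, Fin.sum_univ_succAbove _ m]
  simp only [Fin.insertNth_apply_same, Fin.insertNth_apply_succAbove]
  ring

/-- The fibre integral along a fibre does not depend on the position on the fibre:
`fibreIntegral m G (insertNth m u s) = ∫_{(0,1-∑s]} G(insertNth m v s) dv` — the normalisation `∫₀^∞ G_i dt_i` of Lemma 6.1 / the denominator `∫ F dt_i` of the weights in the proof of Corollary 6.2 is a function of the outer point only. [cite: Polymath8b2014, proof of Corollary 6.2] -/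
theorem fibreIntegral_insertNth (m : Fin (n + 1)) (G : (Fin (n + 1) → ℝ) → ℝ) (u : ℝ) (s : Fin n → ℝ) :
    fibreIntegral m G (Fin.insertNth m u s) = ∫ v in Ioc (0:ℝ) (1 - ∑ j, s j), G (Fin.insertNth m v s) := by
  rw [fibreIntegral, sub_sum_erase_insertNth]
  simp_rw [Fin.update_insertNth]

/-- The fibre integral written as a whole-line integral of a jointly measurable integrand (for Fubini
measurability). [folklore] -/
private theorem fibreIntegral_eq_integral_ite (m : Fin (n + 1)) (G : (Fin (n + 1) → ℝ) → ℝ) (t : Fin (n + 1) → ℝ) :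
    fibreIntegral m G t =
      ∫ u, (fun p : (Fin (n + 1) → ℝ) × ℝ =>
        if 0 < p.2 ∧ p.2 ≤ 1 - ∑ j ∈ univ.erase m, p.1 j then G (Function.update p.1 m p.2) else 0) (t, u) := by
  rw [fibreIntegral, ← integral_indicator measurableSet_Ioc]
  refine integral_congr_ae (ae_of_all _ fun u => ?_)
  simp only [Set.indicator, Set.mem_Ioc]

/-- `t ↦ (P_m G)(t)` is measurable for measurable `G` (Fubini) — the measurability half of "`ℒ` is an operator on `L²(R_k)`". [cite: Polymath8b2014, §7.1 (the operator L on L²(R_k), p. 30)] -/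
theorem measurable_fibreIntegral (m : Fin (n + 1)) {G : (Fin (n + 1) → ℝ) → ℝ} (hG : Measurable G) :
    Measurable (fibreIntegral m G) := by
  have hΦ : Measurable fun p : (Fin (n + 1) → ℝ) × ℝ =>
      if 0 < p.2 ∧ p.2 ≤ 1 - ∑ j ∈ univ.erase m, p.1 j then G (Function.update p.1 m p.2) else 0 := by
    refine Measurable.ite ?_ (hG.comp measurable_update') measurable_const
    refine (measurableSet_lt measurable_const measurable_snd).inter ?_
    exact measurableSet_le measurable_snd (measurable_const.sub
      (Finset.measurable_sum _ fun j _ => (measurable_pi_apply j).comp measurable_fst))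
  have h := (hΦ.stronglyMeasurable).integral_prod_right' (ν := (volume : Measure ℝ))
  have hfun : (fun t => fibreIntegral m G t) = fun t => ∫ u, (fun p : (Fin (n + 1) → ℝ) × ℝ =>
      if 0 < p.2 ∧ p.2 ≤ 1 - ∑ j ∈ univ.erase m, p.1 j then G (Function.update p.1 m p.2) else 0) (t, u) := by
    funext t; exact fibreIntegral_eq_integral_ite m G t
  rw [show fibreIntegral m G = fun t => fibreIntegral m G t from rfl, hfun]
  exact h.measurable

/-- `t ↦ (ℒG)(t)` is measurable for measurable `G` — the measurability half of "`ℒ` is an operator on `L²(R_k)`". [cite: Polymath8b2014, §7.1 (the operator L on L²(R_k), p. 30)] -/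
theorem measurable_maynardOperator {G : (Fin (n + 1) → ℝ) → ℝ} (hG : Measurable G) :
    Measurable (maynardOperator G) :=
  Finset.measurable_sum _ fun m _ => measurable_fibreIntegral m hG

/-- A section `v ↦ G(insertNth m v s)` of a function that is measurable and bounded on `R_{n+1}` is
integrable on the fibre `(0, 1-∑s]` over an outer point `s ≥ 0`. [folklore] -/
private theorem integrableOn_section (m : Fin (n + 1)) {G : (Fin (n + 1) → ℝ) → ℝ} (hG : Measurable G) {B : ℝ}
    (hB : ∀ t ∈ maynardSimplex (n + 1), |G t| ≤ B) {s : Fin n → ℝ} (hs : ∀ j, 0 ≤ s j) :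
    IntegrableOn (fun v => G (Fin.insertNth m v s)) (Ioc (0:ℝ) (1 - ∑ j, s j)) := by
  have hgm : Measurable fun v : ℝ => G (Fin.insertNth m v s) :=
    hG.comp (continuous_id.finInsertNth m continuous_const).measurable
  refine Measure.integrableOn_of_bounded (M := B) (by simp [Real.volume_Ioc]) hgm.aestronglyMeasurable ?_
  rw [ae_restrict_iff' measurableSet_Ioc]
  refine ae_of_all _ fun v hv => ?_
  rw [Real.norm_eq_abs]
  exact hB _ ((MaynardLargeK.insertNth_mem_maynardSimplex_iff m v s).2 ⟨⟨hv.1.le, hs⟩, by linarith [hv.2]⟩)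

/-- Positivity of the fibre integral over a fibre of positive length when `G > 0` on `R_{n+1}`.
[folklore] -/
private theorem fibreIntegral_insertNth_pos (m : Fin (n + 1)) {G : (Fin (n + 1) → ℝ) → ℝ} (hG : Measurable G)
    {B : ℝ} (hB : ∀ t ∈ maynardSimplex (n + 1), |G t| ≤ B) (hGpos : ∀ t ∈ maynardSimplex (n + 1), 0 < G t)
    {s : Fin n → ℝ} (hs : ∀ j, 0 ≤ s j) (hs1 : ∑ j, s j < 1) :
    0 < ∫ v in Ioc (0:ℝ) (1 - ∑ j, s j), G (Fin.insertNth m v s) := by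
  have hL : 0 < 1 - ∑ j, s j := by linarith
  rw [← intervalIntegral.integral_of_le hL.le]
  refine intervalIntegral.intervalIntegral_pos_of_pos_on ?_ (fun v hv => hGpos _ ?_) hL
  · exact (intervalIntegrable_iff_integrableOn_Ioc_of_le hL.le).2 (integrableOn_section m hG hB hs)
  · exact (MaynardLargeK.insertNth_mem_maynardSimplex_iff m v s).2 ⟨⟨hv.1.le, hs⟩, by linarith [hv.2]⟩

/-- Nonnegativity of the fibre integral when `G > 0` on `R_{n+1}` and `s ≥ 0`. [folklore] -/
private theorem fibreIntegral_insertNth_nonneg (m : Fin (n + 1)) {G : (Fin (n + 1) → ℝ) → ℝ}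
    (hGpos : ∀ t ∈ maynardSimplex (n + 1), 0 < G t) {s : Fin n → ℝ} (hs : ∀ j, 0 ≤ s j) :
    0 ≤ ∫ v in Ioc (0:ℝ) (1 - ∑ j, s j), G (Fin.insertNth m v s) :=
  setIntegral_nonneg measurableSet_Ioc fun v hv => (hGpos _
    ((MaynardLargeK.insertNth_mem_maynardSimplex_iff m v s).2 ⟨⟨hv.1.le, hs⟩, by linarith [hv.2]⟩)).le

end MaynardCW

open MaynardCW in
/-- **Collatz–Wielandt upper bound for `M_k` (Polymath 8b Lemma 6.1 with the weights of the proof of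
Corollary 6.2).**  Let `G` be measurable, bounded and strictly positive on `R_{n+1}`, and suppose the
sub-eigenfunction inequality `(ℒG)(t) = ∑_m ∫₀^{1-∑_{j≠m}t_j} G(t with t_m := u) du ≤ Λ·G(t)` holds at every
point of `R_{n+1}`.  Then `(∑_m J^{(m)}(F))/I(F) ≤ Λ` for EVERY admissible `F`, i.e. `M_{n+1} ≤ Λ`.
(Proof as printed for Corollary 6.2: apply Lemma 6.1 with `G_m := G/(∫ G dt_m)`, so that `∫ G_m dt_m = 1` and
`∑_m 1/G_m = (ℒG)/G ≤ Λ`.)  With `ℒG = λG` for a positive eigenfunction this is the upper half of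
Corollary 6.2 (`M_k = λ`); Corollary 6.4 is the instance behind `maynardFunctional_le_holds`.
[cite: Polymath8b2014, Lemma 6.1 and proof of Corollary 6.2] -/
theorem maynardFunctional_le_of_subsolution {n : ℕ} {Λ : ℝ} {G : (Fin (n + 1) → ℝ) → ℝ}
    (hG : Measurable G) {B : ℝ} (hB : ∀ t ∈ maynardSimplex (n + 1), |G t| ≤ B)
    (hGpos : ∀ t ∈ maynardSimplex (n + 1), 0 < G t)
    (hsub : ∀ t ∈ maynardSimplex (n + 1), maynardOperator G t ≤ Λ * G t)
    {F : (Fin (n + 1) → ℝ) → ℝ} (hF : IsMaynardAdmissible (n + 1) F) :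
    maynardFunctional (n + 1) F ≤ Λ := by
  -- `Λ ≥ 0`: evaluate the hypothesis at the origin, where `ℒG ≥ 0 < G`.
  have h0mem : (fun _ => (0:ℝ)) ∈ maynardSimplex (n + 1) := ⟨fun _ => le_rfl, by simp⟩
  have hΛ : 0 ≤ Λ := by
    have h1 : 0 ≤ maynardOperator G (fun _ => (0:ℝ)) := by
      refine Finset.sum_nonneg fun m _ => setIntegral_nonneg measurableSet_Ioc fun u hu => (hGpos _ ?_).le
      refine ⟨fun i => ?_, ?_⟩
      · by_cases hi : i = m
        · subst hi; simp [hu.1.le]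
        · simp [Function.update_of_ne hi]
      · have hu2 : u ≤ 1 := by simpa using hu.2
        rw [Finset.sum_update_of_mem (Finset.mem_univ m)]
        simpa using hu2
    nlinarith [hsub _ h0mem, hGpos _ h0mem]
  -- the weights `w_m = (P_m G)/G`
  set w : Fin (n + 1) → (Fin (n + 1) → ℝ) → ℝ := fun m t => fibreIntegral m G t / G t with hw
  have hwm : ∀ m, Measurable (w m) := fun m => (measurable_fibreIntegral m hG).div hG
  -- value of the weight on a fibre
  have hw_fibre : ∀ m (u : ℝ) (s : Fin n → ℝ), w m (Fin.insertNth m u s) =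
      (∫ v in Ioc (0:ℝ) (1 - ∑ j, s j), G (Fin.insertNth m v s)) / G (Fin.insertNth m u s) := by
    intro m u s; simp only [hw, fibreIntegral_insertNth]
  refine maynardFunctional_le_of_weights' hΛ hF w hwm ?_ ?_ ?_ ?_
  · -- positivity where `F ≠ 0`, `t_m > 0`
    intro m t hFt htm
    have ht : t ∈ maynardSimplex (n + 1) := hF.support_subset (Function.mem_support.2 hFt)
    obtain ⟨u, s, rfl⟩ : ∃ u s, t = Fin.insertNth m u s :=
      ⟨t m, fun j => t (m.succAbove j), (Fin.insertNth_self_removeNth m t).symm⟩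
    have h' := (MaynardLargeK.insertNth_mem_maynardSimplex_iff m u s).1 ht
    have hu : 0 < u := by simpa using htm
    rw [hw_fibre]
    exact div_pos (fibreIntegral_insertNth_pos m hG hB hGpos h'.1.2 (by linarith [h'.2])) (hGpos _ ht)
  · -- nonnegativity on `R_{n+1}`
    intro m t ht
    obtain ⟨u, s, rfl⟩ : ∃ u s, t = Fin.insertNth m u s :=
      ⟨t m, fun j => t (m.succAbove j), (Fin.insertNth_self_removeNth m t).symm⟩
    have h' := (MaynardLargeK.insertNth_mem_maynardSimplex_iff m u s).1 ht
    rw [hw_fibre]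
    exact div_nonneg (fibreIntegral_insertNth_nonneg m hGpos h'.1.2) (hGpos _ ht).le
  · -- fibre budgets: `∫_{(0,1-∑s]} G(insertNth m u s)/C du = 1` with `C = ∫_{(0,1-∑s]} G(insertNth m · s)`
    intro m s hs0 hs1
    rcases eq_or_lt_of_le hs1 with h1 | h1
    · simp [h1]
    set C := ∫ v in Ioc (0:ℝ) (1 - ∑ j, s j), G (Fin.insertNth m v s) with hC
    have hCpos : 0 < C := fibreIntegral_insertNth_pos m hG hB hGpos hs0 h1
    have hint : IntegrableOn (fun v => G (Fin.insertNth m v s)) (Ioc (0:ℝ) (1 - ∑ j, s j)) :=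
      integrableOn_section m hG hB hs0
    have hnn : ∀ u ∈ Ioc (0:ℝ) (1 - ∑ j, s j), 0 ≤ G (Fin.insertNth m u s) / C := fun u hu =>
      div_nonneg (hGpos _ ((MaynardLargeK.insertNth_mem_maynardSimplex_iff m u s).2
        ⟨⟨hu.1.le, hs0⟩, by linarith [hu.2]⟩)).le hCpos.le
    calc ∫⁻ u in Ioc (0:ℝ) (1 - ∑ j, s j), ENNReal.ofReal (w m (Fin.insertNth m u s))⁻¹
        = ∫⁻ u in Ioc (0:ℝ) (1 - ∑ j, s j), ENNReal.ofReal (G (Fin.insertNth m u s) / C) := by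
          refine setLIntegral_congr_fun measurableSet_Ioc fun u hu => ?_
          rw [hw_fibre, ← hC, inv_div]
      _ = ENNReal.ofReal (∫ u in Ioc (0:ℝ) (1 - ∑ j, s j), G (Fin.insertNth m u s) / C) := by
          rw [ofReal_integral_eq_lintegral_ofReal (hint.div_const C)]
          filter_upwards [ae_restrict_mem measurableSet_Ioc] with u hu using hnn u hu
      _ ≤ 1 := le_of_eq (by rw [integral_div, ← hC, div_self hCpos.ne', ENNReal.ofReal_one])
  · -- pointwise: `∑_m (P_m G)/G = (ℒG)/G ≤ Λ`
    intro t ht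
    have hGt := hGpos t ht
    simp only [hw]
    rw [← Finset.sum_div, div_le_iff₀ hGt, ← maynardOperator_def]
    exact hsub t ht

open MaynardCW in
/-- **Collatz–Wielandt bound, continuous test function.** For CONTINUOUS `G > 0` on `R_{n+1}` with
`(ℒG)(t) ≤ Λ·G(t)` on `R_{n+1}`, every admissible `F` has `(∑_m J^{(m)}(F))/I(F) ≤ Λ` (boundedness on the
compact `R_{n+1}` is automatic).  This is the form consumed by polynomial / product test-function
certificates. [cite: Polymath8b2014, Lemma 6.1 and proof of Corollary 6.2] -/
theorem maynardFunctional_le_of_subsolution_of_continuous {n : ℕ} {Λ : ℝ} {G : (Fin (n + 1) → ℝ) → ℝ}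
    (hG : Continuous G) (hGpos : ∀ t ∈ maynardSimplex (n + 1), 0 < G t)
    (hsub : ∀ t ∈ maynardSimplex (n + 1), maynardOperator G t ≤ Λ * G t)
    {F : (Fin (n + 1) → ℝ) → ℝ} (hF : IsMaynardAdmissible (n + 1) F) :
    maynardFunctional (n + 1) F ≤ Λ := by
  obtain ⟨B, hB⟩ := (isCompact_maynardSimplex (n + 1)).bddAbove_image (f := fun t => |G t|)
    (continuous_abs.comp hG).continuousOn
  exact maynardFunctional_le_of_subsolution hG.measurable (B := B)
    (fun t ht => hB (Set.mem_image_of_mem _ ht)) hGpos hsub hF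

end Literature.NumberTheory.Sieve
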